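import Literature.NumberTheory.GaloisRepresentations.WeakAbelianDirectSummandDivisibilityProofs
import Literature.NumberTheory.GaloisRepresentations.LAdicCharacterIdelicProofs
import Literature.NumberTheory.GaloisRepresentations.LAdicCharacterIdelicValuesProofs
import HarnessLib

/-!
# Weak abelian direct summands: the idele class character and its algebraic values (proved)

Topic `NumberTheory/GaloisRepresentations`; namespace
`Literature.NumberTheory.GaloisRepresentations`.  A *proofs* file (theorems only; no definition,
no named fact, no instance), sibling of `WeakAbelianDirectSummand.lean` (Böckle–Hui 2025,
Thm. 1.1, the named fact `exists_heckeCharacter_of_weaklyDivides`).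

The first step of the printed proof of BH Thm. 1.1 (§2.7: "there exists `N ∈ ℕ` such that `ψ_ℓ^N`
is locally algebraic by `E`-rationality of `ρ_ℓ` and Theorem 2.2") applies the `ℓ`-adic
transcendence theorem (Thm. 2.2, Waldschmidt/Henniart; for `K = ℚ` Serre, Ch. III §3) to the
character `ψ`.  In Serre's proof that theorem is fed with the idele class character
`Ψ = ψ ∘ Art_K` (BH §2.3) and with the algebraicity of its values
`f(k) = ∏_{v ∣ ℓ} Ψ(⟨k⟩_v)` at the global elements `k ∈ Kˣ` prime to the ramification.  This
file assembles exactly these hypotheses for a character `ψ` weakly dividing an `E`-rational `ρ`,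
from three proved ingredients of the tree:

* `WeaklyDivides.eventually_isAlgebraic` (`…DivisibilityProofs`): `ψ(Frob_v)` is algebraic for
  almost all `v` (BH Prop. 2.4 in the strong form + `E`-rationality);
* `FramedGaloisRep.exists_idelicCharacter` (`LAdicCharacterIdelicProofs`): the idele class
  character `Ψ` of `ψ` with `Ψ(⟨ϖ_v⟩_v) = ψ(Frob_v)`, `Ψ(⟨𝒪_vˣ⟩_v) = 1` at the unramified `v`;
* `IdelicCharacter.isAlgebraic_prod_map_localUnits` (`LAdicCharacterIdelicValuesProofs`): Serre's
  product-formula computation of `f(k)`.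

Result: **`WeaklyDivides.exists_idelicCharacter_isAlgebraic`** — for `ψ` weakly dividing an
`E`-rational `ρ : Γ_K → GL_n(ℚ̄_ℓ)` there are a continuous `Ψ : 𝕀_K →ₜ* ℚ̄_ℓˣ` trivial on `Kˣ` and
a finite set `S` of finite places containing those above `ℓ`, such that off `S`: `ψ` is
unramified, `Ψ(⟨𝒪_vˣ⟩_v) = 1`, `ψ(Frob_v) = Ψ(⟨ϖ⟩_v)` for every `ϖ` of valuation one, these values
are algebraic numbers; and for every `k ∈ Kˣ` which is a unit at the places of `S` not above `ℓ`,
`f(k) = ∏_{v ∈ S, v ∣ ℓ} Ψ(⟨k⟩_v)` is algebraic over `ℚ`.  What then remains of BH Thm. 2.2 for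
`ψ` is the purely analytic statement about the continuous homomorphism
`f : ∏_{v ∣ ℓ} K_vˣ → ℚ̄_ℓˣ` (Waldschmidt 1981, Part II; Henniart 1982).

## References

* G. Böckle, C.-Y. Hui, *Weak abelian direct summands and irreducibility of Galois
  representations*, Math. Ann. 393 (2025), §2.3–§2.4, Thm. 2.2, §2.7. [BockleHui2025]
* J.-P. Serre, *Abelian ℓ-adic representations and elliptic curves* (1968), Ch. III §2–§3.
  [SerreAbelianLadic1968]
-/

noncomputable section

open scoped NumberField Polynomial Topology
open NumberField IsDedekindDomain IsDedekindDomain.HeightOneSpectrum Field Polynomial Filter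

namespace Literature.NumberTheory.GaloisRepresentations

namespace FramedGaloisRep

variable {K : Type} [Field K] [NumberField K] {ℓ : ℕ} [Fact ℓ.Prime] {n : ℕ}

/-- **The idele class character of a weak abelian direct summand and the algebraicity of its
values** (the hypotheses of BH Thm. 2.2 / Serre III §3 for `ψ`, in analytic form).  Let
`ρ : Γ_K → GL_n(ℚ̄_ℓ)` be `E`-rational (`E` a number field, `e : E → ℚ̄_ℓ`) and let the character
`ψ : Γ_K → GL_1(ℚ̄_ℓ)` weakly divide `ρ`.  Then there are a continuous `Ψ : 𝕀_K →ₜ* ℚ̄_ℓˣ` with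
`Ψ(Kˣ) = 1` and a finite set `S` of finite places containing the places above `ℓ` such that:
(i) for `v ∉ S`, `ψ` is unramified at `v`, `Ψ(⟨𝒪_vˣ⟩_v) = 1`, and `ψ(Frob_v) = Ψ(⟨ϖ⟩_v)` for every
`ϖ ∈ K_v` of valuation one; (ii) for `v ∉ S` the value `Ψ(⟨ϖ_v⟩_v)` is an algebraic number;
(iii) for every `k ∈ Kˣ` which is a unit at the places of `S` not above `ℓ`, the product
`∏_{v ∈ S, v ∣ ℓ} Ψ(⟨k⟩_v)` is algebraic over `ℚ`.
[cite: BockleHui2025, §2.3–§2.4 and §2.7 (first step of the proof of Thm. 1.1)] [cite: SerreAbelianLadic1968, Ch. III §2.3, §3] -/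
theorem WeaklyDivides.exists_idelicCharacter_isAlgebraic
    [DecidablePred fun v : HeightOneSpectrum (𝓞 K) => (ℓ : 𝓞 K) ∈ v.asIdeal]
    {E : Type*} [Field E] [NumberField E] (e : E →+* PadicAlgCl ℓ)
    {ρ : FramedGaloisRep K (PadicAlgCl ℓ) n} (hρ : ρ.IsRationalOver e)
    {ψ : FramedGaloisRep K (PadicAlgCl ℓ) 1} (h : ψ.WeaklyDivides ρ) :
    ∃ Ψ : ideleGroup K →ₜ* (PadicAlgCl ℓ)ˣ, (∀ x ∈ principalIdeles K, Ψ x = 1) ∧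
      ∃ S : Finset (HeightOneSpectrum (𝓞 K)),
        (∀ v : HeightOneSpectrum (𝓞 K), (ℓ : 𝓞 K) ∈ v.asIdeal → v ∈ S) ∧
        (∀ v ∉ S, ψ.IsUnramifiedAt v ∧
          (∀ u : (v.adicCompletionIntegers K)ˣ,
            Ψ (localUnits v (Units.map ((v.adicCompletionIntegers K).subtype : _ →* _) u)) = 1) ∧
          ∀ ϖ : (v.adicCompletion K)ˣ,
            Valued.v (ϖ : v.adicCompletion K) = WithZero.exp (-1 : ℤ) →
              ψ.HasFrobCharpolyAt v
                (X - C ((Ψ (localUnits v ϖ) : (PadicAlgCl ℓ)ˣ) : PadicAlgCl ℓ))) ∧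
        (∀ v ∉ S, IsAlgebraic ℚ
          ((Ψ (localUnits v (HeckeCharacter.uniformizer K v)) : (PadicAlgCl ℓ)ˣ) :
            PadicAlgCl ℓ)) ∧
        ∀ k : Kˣ, (∀ v ∈ S, (ℓ : 𝓞 K) ∉ v.asIdeal → v.valuation K (k : K) = 1) →
          IsAlgebraic ℚ ((∏ v ∈ S.filter (fun v => (ℓ : 𝓞 K) ∈ v.asIdeal),
            Ψ (localUnits v (globalToLocalUnits v k)) : (PadicAlgCl ℓ)ˣ) : PadicAlgCl ℓ) := by
  classical
  obtain ⟨Ψ, hK, hloc⟩ := ψ.exists_idelicCharacter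
  -- the finite exceptional set: bad places for `ψ` and the places above `ℓ`
  -- (finiteness of the latter: `finite_setOf_natCast_mem` of `CyclotomicDirichletDensity`)
  have hgood := WeaklyDivides.eventually_isAlgebraic e hρ h
  rw [Filter.eventually_cofinite] at hgood
  set S : Finset (HeightOneSpectrum (𝓞 K)) :=
    hgood.toFinset ∪ (finite_setOf_natCast_mem (K := K) (m := ℓ)).toFinset with hS
  have hSℓ : ∀ v : HeightOneSpectrum (𝓞 K), (ℓ : 𝓞 K) ∈ v.asIdeal → v ∈ S := fun v hv =>
    Finset.mem_union_right _ ((Set.Finite.mem_toFinset _).mpr hv)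
  have hSgood : ∀ v ∉ S, ρ.IsUnramifiedAt v ∧ ψ.IsUnramifiedAt v ∧
      ∀ 𝔓 ∈ v.primesAbove, ∀ σ : absoluteGaloisGroup K, IsArithFrobAt (𝓞 K) σ 𝔓 →
        IsAlgebraic ℚ ((((ψ σ : GL (Fin 1) (PadicAlgCl ℓ)) :
          Matrix (Fin 1) (Fin 1) (PadicAlgCl ℓ)) 0 0)) := by
    intro v hv
    by_contra hbad
    exact hv (Finset.mem_union_left _ ((Set.Finite.mem_toFinset _).mpr hbad))
  -- (i) the local description off `S`
  have hi : ∀ v ∉ S, ψ.IsUnramifiedAt v ∧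
      (∀ u : (v.adicCompletionIntegers K)ˣ,
        Ψ (localUnits v (Units.map ((v.adicCompletionIntegers K).subtype : _ →* _) u)) = 1) ∧
      ∀ ϖ : (v.adicCompletion K)ˣ,
        Valued.v (ϖ : v.adicCompletion K) = WithZero.exp (-1 : ℤ) →
          ψ.HasFrobCharpolyAt v
            (X - C ((Ψ (localUnits v ϖ) : (PadicAlgCl ℓ)ˣ) : PadicAlgCl ℓ)) :=
    fun v hv => ⟨(hSgood v hv).2.1, hloc v (hSgood v hv).2.1⟩
  -- (ii) the Frobenius values are algebraic
  have hii : ∀ v ∉ S, IsAlgebraic ℚ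
      ((Ψ (localUnits v (HeckeCharacter.uniformizer K v)) : (PadicAlgCl ℓ)ˣ) :
        PadicAlgCl ℓ) := by
    intro v hv
    obtain ⟨𝔓, h𝔓⟩ := v.primesAbove_nonempty
    obtain ⟨σ, hσ⟩ := HeightOneSpectrum.exists_isArithFrobAt_of_mem_primesAbove_holds h𝔓
    have hfrob := (FramedGaloisRep.hasFrobCharpolyAt_iff_of_rank_one ψ v _).mp
      ((hi v hv).2.2 _ (HeckeCharacter.valued_uniformizer v)) 𝔓 h𝔓 σ hσ
    rw [← hfrob]
    exact (hSgood v hv).2.2 𝔓 h𝔓 σ hσ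
  refine ⟨Ψ, hK, S, hSℓ, hi, hii, fun k hk => ?_⟩
  -- (iii) Serre's computation
  exact IdelicCharacter.isAlgebraic_prod_map_localUnits Ψ hK S (fun v hv => (hi v hv).2.1) hii k hk

end FramedGaloisRep

end Literature.NumberTheory.GaloisRepresentations

end
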